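import Mathlib.MeasureTheory.Integral.Bochner.Basic
import Mathlib.MeasureTheory.Function.L2Space
import Mathlib.Analysis.SpecialFunctions.Log.Basic
import Mathlib.Analysis.SpecialFunctions.ExpDeriv
import Mathlib.Analysis.Calculus.Taylor
import Mathlib.Probability.Notation
import HarnessLib

/-!
# `SourcedPressureIncrement` (stmt-QuantumFields-22517), line `birth`: a ONE-SIDED second-order bound for `log E e^{−hZ}` by
# UNTILTED moments (the window form of the `h`-expansion for unbounded sources, e.g. the Gaussian `H_B` of `gaussIncrement`)

Helper toward the deciding crux stmt-QuantumFields-22517 (`SourcedPressureJensen.SourcedPressureIncrement`) and its free-cell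
children (KS1′ stmt-QuantumFields-23996, KS2′ stmt-QuantumFields-24028), whose plans name the step «Taylor in `h` to second
order» for a sourced pressure `log E e^{−hH}`.  The lead's `…ColdBoxSourcedPressureCgfTaylorBound` gives that step with the
TILTED variance (Mathlib's `cgf`, needs exponential moments on a neighbourhood of `0`) and its window form for BOUNDED `H`.  The
Gaussian source `H_B = Σ_{x∈B} A_xA_{x+ne₀}` of `gaussIncrement` is unbounded with NO positive exponential moment (`A_xA_{x'}` has
an `exp(−c√s)` upper tail), so `0` is not interior to its `integrableExpSet`; this file gives the one-sided substitute that uses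
only NEGATIVE exponential moments and untilted moments:

* `exp_le_one_add_add_sq_half_mul` — the pointwise inequality `e^x ≤ 1 + x + (x²/2)(1 + e^x)` for ALL real `x` (Taylor–Lagrange:
  `e^x = 1 + x + e^ξ x²/2` with `e^ξ ≤ max(1, e^x)`);
* **`log_integral_exp_neg_mul_le_of_moments`** — for a probability measure, a centred `Z` (`∫Z = 0`) with `Z`, `Z²`, `Z⁴`, `e^{−hZ}` and
  `e^{−2hZ}` integrable: `log ∫ e^{−hZ} ≤ (h²/2)·(∫Z² + (∫Z⁴)^{1/2}·(∫e^{−2hZ})^{1/2})` (pointwise bound, Cauchy–Schwarz on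
  `Z²·e^{−hZ}`, `log(1+v) ≤ v`);
* `log_integral_exp_neg_mul_le_of_moments'` — the same with a general mean: `log ∫e^{−hH} ≤ −h∫H + (h²/2)(…)` for `Z = H − ∫H`.

In the Gaussian application (`…GaussIncrementWindow`): `∫Z² ≤ M₂|B|` (`gauss_secondCumulant_le`), `∫Z⁴ ≤ K₄|B|⁴`,
`∫e^{−2hZ} ≤ e^{c·h|B|}` (`gauss_increment_jensen_uniform`), whence `log E_γ e^{−hH_B} ≤ −h E H_B + M h²|B|²` in the window
`h|B| ≤ h₀`.  Mathlib only; theorems only.  RECORD-label rung support (all-`G` leaf `WeakCouplingRates.XiPow`); the Yang–Mills mass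
gap is NOT proved by anything here. [folklore]
-/

noncomputable section

open MeasureTheory ProbabilityTheory Real Set

namespace Summit.QuantumFields.YangMills.Cruxes.SourcedPressureIncrement.Birth

/-! ### §1 The pointwise inequality -/

/-- **`e^x ≤ 1 + x + (x²/2)(1 + e^x)` for every real `x`**: Taylor–Lagrange `e^x = 1 + x + e^ξ·x²/2` with `ξ` between `0` and
`x`, and `e^ξ ≤ max(1, e^x) ≤ 1 + e^x`. [folklore] -/
theorem exp_le_one_add_add_sq_half_mul (x : ℝ) : exp x ≤ 1 + x + x ^ 2 / 2 * (1 + exp x) := by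
  rcases eq_or_ne x 0 with rfl | hx
  · simp
  have hcd : ContDiffOn ℝ 2 exp (uIcc 0 x) := contDiff_exp.contDiffOn
  obtain ⟨ξ, hξ, hT⟩ := taylor_mean_remainder_lagrange_iteratedDeriv (f := exp) (n := 1) hx.symm hcd
  have hu : UniqueDiffOn ℝ (uIcc 0 x) := uniqueDiffOn_Icc (min_lt_max.2 hx.symm)
  have h0mem : (0 : ℝ) ∈ uIcc 0 x := left_mem_uIcc
  have hder : derivWithin exp (uIcc 0 x) 0 = 1 := by
    rw [(Real.differentiable_exp 0).derivWithin (hu 0 h0mem), Real.deriv_exp, exp_zero]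
  have hT1 : taylorWithinEval exp 1 (uIcc 0 x) 0 x = 1 + x := by
    rw [taylorWithinEval_succ, taylor_within_zero_eval, exp_zero, iteratedDerivWithin_one, hder]
    simp
  have h2 : iteratedDeriv 2 exp ξ = exp ξ := by
    rw [iteratedDeriv_eq_iterate, iter_deriv_exp]
  rw [hT1, h2] at hT
  -- `e^ξ ≤ 1 + e^x`
  have hξle : exp ξ ≤ 1 + exp x := by
    have hξ' : ξ ≤ max 0 x := by
      rcases le_or_gt 0 x with h | h
      · rw [uIoo_of_le h] at hξ; rw [max_eq_right h]; exact hξ.2.le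
      · rw [uIoo_of_ge h.le] at hξ; rw [max_eq_left h.le]; exact hξ.2.le
    calc exp ξ ≤ exp (max 0 x) := exp_le_exp.2 hξ'
      _ = max (exp 0) (exp x) := Monotone.map_max exp_monotone
      _ ≤ 1 + exp x := by rw [exp_zero]; exact max_le (by linarith [exp_pos x]) (by linarith)
  have hx2 : 0 ≤ x ^ 2 / 2 := by positivity
  have key : exp x - (1 + x) = exp ξ * x ^ 2 / 2 := by
    rw [hT]; simp [Nat.factorial]
  nlinarith [mul_le_mul_of_nonneg_left hξle hx2]

/-! ### §2 The one-sided second-order bound by untilted moments -/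

variable {Ω : Type*} {mΩ : MeasurableSpace Ω} {μ : Measure Ω}

/-- **ONE-SIDED SECOND-ORDER BOUND FOR `log E e^{−hZ}` BY UNTILTED MOMENTS.**  For a probability measure `μ`, a centred `Z`
(`∫ Z dμ = 0`) with `Z`, `Z⁴`, `e^{−hZ}`, `e^{−2hZ}` integrable:
`log ∫ e^{−hZ} dμ ≤ (h²/2) · (∫ Z² dμ + (∫ Z⁴ dμ)^{1/2} · (∫ e^{−2hZ} dμ)^{1/2})`.
Proof: `e^{−hZ} ≤ 1 − hZ + (h²Z²/2)(1 + e^{−hZ})` pointwise, `∫ Z²e^{−hZ} ≤ ‖Z²‖₂‖e^{−hZ}‖₂` (Cauchy–Schwarz), `log(1 + v) ≤ v`.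
Only NEGATIVE exponential moments of `Z` enter. [folklore] -/
theorem log_integral_exp_neg_mul_le_of_moments [IsProbabilityMeasure μ] {Z : Ω → ℝ} {h : ℝ}
    (hZ0 : ∫ ω, Z ω ∂μ = 0) (hZ1 : Integrable Z μ)
    (hZ2 : Integrable (fun ω => Z ω ^ 2) μ) (hZ4 : Integrable (fun ω => Z ω ^ 4) μ)
    (hE1 : Integrable (fun ω => exp (-(h * Z ω))) μ) (hE2 : Integrable (fun ω => exp (-(2 * h * Z ω))) μ) :
    Real.log (∫ ω, exp (-(h * Z ω)) ∂μ) ≤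
      h ^ 2 / 2 * (∫ ω, Z ω ^ 2 ∂μ + (∫ ω, Z ω ^ 4 ∂μ) ^ (1 / 2 : ℝ) * (∫ ω, exp (-(2 * h * Z ω)) ∂μ) ^ (1 / 2 : ℝ)) := by
  -- Cauchy–Schwarz for `Z² · e^{−hZ}`
  have hf2 : MemLp (fun ω => Z ω ^ 2) (ENNReal.ofReal 2) μ := by
    rw [show ENNReal.ofReal 2 = 2 by norm_num, memLp_two_iff_integrable_sq hZ2.aestronglyMeasurable]
    refine hZ4.congr (ae_of_all _ fun ω => ?_)
    simp only; ring
  have hg2 : MemLp (fun ω => exp (-(h * Z ω))) (ENNReal.ofReal 2) μ := by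
    rw [show ENNReal.ofReal 2 = 2 by norm_num, memLp_two_iff_integrable_sq hE1.aestronglyMeasurable]
    refine hE2.congr (ae_of_all _ fun ω => ?_)
    simp only
    rw [← Real.exp_nat_mul]; ring_nf
  have hCS := integral_mul_le_Lp_mul_Lq_of_nonneg Real.HolderConjugate.two_two
    (ae_of_all _ fun ω => sq_nonneg (Z ω)) (ae_of_all _ fun ω => (exp_pos _).le) hf2 hg2
  have hp4 : ∫ ω, (Z ω ^ 2) ^ (2 : ℝ) ∂μ = ∫ ω, Z ω ^ 4 ∂μ := by
    refine integral_congr_ae (ae_of_all _ fun ω => ?_)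
    simp only
    rw [show (2 : ℝ) = ((2 : ℕ) : ℝ) by norm_num, Real.rpow_natCast]; ring
  have hq2 : ∫ ω, exp (-(h * Z ω)) ^ (2 : ℝ) ∂μ = ∫ ω, exp (-(2 * h * Z ω)) ∂μ := by
    refine integral_congr_ae (ae_of_all _ fun ω => ?_)
    simp only
    rw [show (2 : ℝ) = ((2 : ℕ) : ℝ) by norm_num, Real.rpow_natCast, ← Real.exp_nat_mul]; ring_nf
  rw [hp4, hq2] at hCS
  -- integrability of `Z² e^{−hZ}` (`2ab ≤ a² + b²`)
  have hprod : Integrable (fun ω => Z ω ^ 2 * exp (-(h * Z ω))) μ := by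
    refine ((hZ4.add hE2).div_const 2).mono' (hZ2.aestronglyMeasurable.mul hE1.aestronglyMeasurable)
      (ae_of_all _ fun ω => ?_)
    rw [Real.norm_eq_abs, abs_of_nonneg (mul_nonneg (sq_nonneg _) (exp_pos _).le)]
    have h2 := two_mul_le_add_sq (Z ω ^ 2) (exp (-(h * Z ω)))
    have e : exp (-(h * Z ω)) ^ 2 = exp (-(2 * h * Z ω)) := by rw [← Real.exp_nat_mul]; ring_nf
    simp only [Pi.add_apply]
    nlinarith [h2, e]
  -- the pointwise inequality integrated
  have hpt : ∀ ω, exp (-(h * Z ω)) ≤ 1 - h * Z ω + h ^ 2 / 2 * (Z ω ^ 2 + Z ω ^ 2 * exp (-(h * Z ω))) := by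
    intro ω
    have := exp_le_one_add_add_sq_half_mul (-(h * Z ω))
    nlinarith [this]
  have iR : Integrable (fun ω => 1 - h * Z ω + h ^ 2 / 2 * (Z ω ^ 2 + Z ω ^ 2 * exp (-(h * Z ω)))) μ :=
    ((integrable_const _).sub (hZ1.const_mul _)).add ((hZ2.add hprod).const_mul _)
  have hint : ∫ ω, exp (-(h * Z ω)) ∂μ ≤
      1 + h ^ 2 / 2 * (∫ ω, Z ω ^ 2 ∂μ + ∫ ω, Z ω ^ 2 * exp (-(h * Z ω)) ∂μ) := by
    refine (integral_mono hE1 iR hpt).trans (le_of_eq ?_)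
    have i1 : Integrable (fun ω => 1 - h * Z ω) μ := (integrable_const _).sub (hZ1.const_mul _)
    have i2 : Integrable (fun ω => h ^ 2 / 2 * (Z ω ^ 2 + Z ω ^ 2 * exp (-(h * Z ω)))) μ := (hZ2.add hprod).const_mul _
    rw [integral_add i1 i2, integral_sub (integrable_const _) (hZ1.const_mul _),
      integral_const_mul, integral_const_mul, integral_add hZ2 hprod, integral_const, probReal_univ, hZ0]
    simp
  -- conclude with `log(1 + v) ≤ v`
  have hpos : 0 < ∫ ω, exp (-(h * Z ω)) ∂μ := integral_exp_pos hE1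
  have hv : ∫ ω, exp (-(h * Z ω)) ∂μ ≤
      1 + h ^ 2 / 2 * (∫ ω, Z ω ^ 2 ∂μ + (∫ ω, Z ω ^ 4 ∂μ) ^ (1 / 2 : ℝ) * (∫ ω, exp (-(2 * h * Z ω)) ∂μ) ^ (1 / 2 : ℝ)) := by
    have hh : 0 ≤ h ^ 2 / 2 := by positivity
    nlinarith [hint, mul_le_mul_of_nonneg_left hCS hh]
  calc Real.log (∫ ω, exp (-(h * Z ω)) ∂μ) ≤ (∫ ω, exp (-(h * Z ω)) ∂μ) - 1 := Real.log_le_sub_one_of_pos hpos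
    _ ≤ _ := by linarith

/-- **General mean**: for `H` with `∫H = m`, `Z = H − m` centred, the same bound reads
`log ∫ e^{−hH} ≤ −h·m + (h²/2)(∫Z² + (∫Z⁴)^{1/2}(∫e^{−2hZ})^{1/2})`. [folklore] -/
theorem log_integral_exp_neg_mul_le_of_moments' [IsProbabilityMeasure μ] {H : Ω → ℝ} {h : ℝ} (hH1 : Integrable H μ)
    (hZ2 : Integrable (fun ω => (H ω - ∫ ω', H ω' ∂μ) ^ 2) μ) (hZ4 : Integrable (fun ω => (H ω - ∫ ω', H ω' ∂μ) ^ 4) μ)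
    (hE1 : Integrable (fun ω => exp (-(h * (H ω - ∫ ω', H ω' ∂μ)))) μ)
    (hE2 : Integrable (fun ω => exp (-(2 * h * (H ω - ∫ ω', H ω' ∂μ)))) μ) :
    Real.log (∫ ω, exp (-(h * H ω)) ∂μ) ≤ -(h * ∫ ω, H ω ∂μ) +
      h ^ 2 / 2 * (∫ ω, (H ω - ∫ ω', H ω' ∂μ) ^ 2 ∂μ +
        (∫ ω, (H ω - ∫ ω', H ω' ∂μ) ^ 4 ∂μ) ^ (1 / 2 : ℝ) *
          (∫ ω, exp (-(2 * h * (H ω - ∫ ω', H ω' ∂μ))) ∂μ) ^ (1 / 2 : ℝ)) := by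
  set m : ℝ := ∫ ω', H ω' ∂μ with hm
  have hZ1 : Integrable (fun ω => H ω - m) μ := hH1.sub (integrable_const _)
  have hZ0 : ∫ ω, (H ω - m) ∂μ = 0 := by
    rw [integral_sub hH1 (integrable_const _), integral_const, probReal_univ, one_smul, hm, sub_self]
  have hmain := log_integral_exp_neg_mul_le_of_moments hZ0 hZ1 hZ2 hZ4 hE1 hE2
  -- `∫ e^{−hH} = e^{−hm} ∫ e^{−hZ}`
  have hsplit : ∫ ω, exp (-(h * H ω)) ∂μ = exp (-(h * m)) * ∫ ω, exp (-(h * (H ω - m))) ∂μ := by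
    rw [← integral_const_mul]
    refine integral_congr_ae (ae_of_all _ fun ω => ?_)
    simp only
    rw [← Real.exp_add]; ring_nf
  have hpos : 0 < ∫ ω, exp (-(h * (H ω - m))) ∂μ := integral_exp_pos hE1
  rw [hsplit, Real.log_mul (exp_pos _).ne' hpos.ne', Real.log_exp]
  linarith

end Summit.QuantumFields.YangMills.Cruxes.SourcedPressureIncrement.Birth
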